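import Summits.CriticalPhenomena.SAWScalingLimit.Theorems.SAWLoopFugacityFlowAvoidanceLimitAnchorDefs
import Summits.CriticalPhenomena.SAWScalingLimit.Theorems.SAWLoopFugacityFlowAvoidanceLimitSawEndpoint
import Summits.CriticalPhenomena.SAWScalingLimit.Theorems.SAWLoopFugacityFlowAvoidanceLimitLinearResponse
import Literature.Probability.LatticeModels.DiluteLoopModelAnalyticity

/-!
# Linear response of the normalised two-leg function in the loop fugacity at `n = 0` —
helper of the lever `stub_cornerLipschitz` of line `saw-corner-germ`
(crux `SAWLoopFugacityFlow.AvoidanceLimit`, stmt-CriticalPhenomena-10649)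

The finite-volume linear response, in the loop fugacity `n` at `n = 0`, of the NORMALISED two-leg
function `twoLegDim n 0 x H Λ a b = Z_{n,0,x}(H, Λ; {a} ∆ {b}) / Z_{n,0,x}(H, Λ; ∅)` of the loop-dressed
self-avoiding walk (dimer fugacity `t = 0`, i.e. the tree's strictly dilute loop model `⟨n, 0, x⟩`) on a
subgraph `H` of `ℤ²`: by the quotient rule applied to the two landed responses
`Corner.hasDerivAt_partitionFunction_zero` (source sets `{a} ∆ {b}` and `∅`), using the `n = 0`
evaluations `Z_{0,0,x}(H, Λ; ∅) = 1` (`DiluteLoopModel.partitionFunction_zero_zero_empty`) and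
`Z_{0,0,x}(H, Λ; {a} ∆ {b}) = Σ_{γ ∈ pathsIn H Λ a b} x^{|γ|}`
(`DiluteLoopModel.partitionFunction_zero_zero_eq_sum_paths`),
`∂ₙ twoLegDim|₀ = Z'_{ab} - (Σ_γ x^{|γ|}) · Z'_∅`, where `Z'_A = Σ_{F : N(F) = 0, loops(F) = 1} x^{|F|}`
is the one-loop generating function with source set `A`: switching on an infinitesimal loop fugacity
dresses the SAW two-point function by one self-avoiding polygon avoiding the walk, minus the vacuum
polygons (the connected part).

Sources: N. Madras, G. Slade, *The Self-Avoiding Walk* (1993), §1.2 [MadrasSlade1993]; J. L. Jacobsen,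
*Conformal field theory applied to loop models*, LNP 775 (2009), §14.3.1 (the limit `n → 0`)
[Jacobsen2009]. No new definitions; nothing about the scaling limit is asserted here.
-/

noncomputable section

open Finset Filter Topology
open scoped symmDiff
open Literature.Probability.RandomPlanarGeometry Literature.Probability.LatticeModels
open Summit.CriticalPhenomena.SAWScalingLimit.Theorems.AvoidanceLimit.Anchor

namespace Summit.CriticalPhenomena.SAWScalingLimit.Theorems.AvoidanceLimit.Corner

/-- At dimer fugacity `t = 0` the normalised two-leg function, as a function of the loop fugacity, is
the quotient of the tree's strictly dilute partition functions `Z_{n,0,x}({a} ∆ {b}) / Z_{n,0,x}(∅)`.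
[folklore] -/
theorem twoLegDim_dimerFugacity_zero_fun (x : ℝ) (H : SimpleGraph (Site 2)) [H.LocallyFinite]
    (Λ : Finset (Site 2)) (a b : Site 2) :
    (fun n : ℝ => twoLegDim n 0 x H Λ a b) =
      fun n : ℝ => (⟨n, 0, x⟩ : DiluteLoopModel ℝ).partitionFunction H Λ ({a} ∆ {b}) /
        (⟨n, 0, x⟩ : DiluteLoopModel ℝ).partitionFunction H Λ ∅ := by
  funext n
  rw [twoLegDim, dimerPF_dimerFugacity_zero, dimerPF_dimerFugacity_zero]

/-- **Linear response of the normalised two-leg function at `n = 0`** (dimer fugacity `t = 0`,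
subgraph `H` of `ℤ²`, `a ≠ b`): `∂ₙ (Z_{n,0,x}(H, Λ; {a} ∆ {b}) / Z_{n,0,x}(H, Λ; ∅))|_{n=0} =
Z'_{ab} - (Σ_{γ ∈ pathsIn H Λ a b} x^{|γ|}) · Z'_∅`, with `Z'_A = Σ_{F ∈ configs(A), N(F) = 0,
loops(F, ∅) = 1} x^{|F|}` the one-loop generating function — the quotient rule on the two landed
responses `hasDerivAt_partitionFunction_zero`, with `Z_{0,0,x}(∅) = 1` and `Z_{0,0,x}({a} ∆ {b})` the
SAW two-point generating function. [cite: Jacobsen2009, §14.3.1 (the limit n → 0: one loop at first order in n)] -/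
theorem hasDerivAt_twoLegDim_zero :
    ∀ (H : SimpleGraph (Site 2)) [H.LocallyFinite], H ≤ zdGraph 2 →
      ∀ (x : ℝ) (Λ : Finset (Site 2)) (a b : Site 2), a ≠ b →
        HasDerivAt (fun n : ℝ => twoLegDim n 0 x H Λ a b)
          ((∑ F ∈ (DiluteLoopModel.configs H Λ ({a} ∆ {b})).filter
              (fun F => DiluteLoopModel.oscVerts Λ F = ∅ ∧ DiluteLoopModel.loops Λ F ∅ = 1), x ^ #F) -
            (∑ p ∈ DiluteLoopModel.pathsIn H Λ a b, x ^ p.length) *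
              (∑ F ∈ (DiluteLoopModel.configs H Λ ∅).filter
                (fun F => DiluteLoopModel.oscVerts Λ F = ∅ ∧ DiluteLoopModel.loops Λ F ∅ = 1), x ^ #F)) 0 := by
  intro H _ hH x Λ a b hab
  rw [twoLegDim_dimerFugacity_zero_fun x H Λ a b]
  have hnum := hasDerivAt_partitionFunction_zero H x Λ ({a} ∆ {b})
  have hden := hasDerivAt_partitionFunction_zero H x Λ ∅
  have h1 : (⟨(0 : ℝ), 0, x⟩ : DiluteLoopModel ℝ).partitionFunction H Λ ∅ = 1 :=
    DiluteLoopModel.partitionFunction_zero_zero_empty hH x Λ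
  have h2 : (⟨(0 : ℝ), 0, x⟩ : DiluteLoopModel ℝ).partitionFunction H Λ ({a} ∆ {b}) =
      ∑ p ∈ DiluteLoopModel.pathsIn H Λ a b, x ^ p.length :=
    DiluteLoopModel.partitionFunction_zero_zero_eq_sum_paths hH x Λ hab
  have hdiv := hnum.div hden (by rw [h1]; exact one_ne_zero)
  refine hdiv.congr_deriv ?_
  rw [h1, h2]
  ring

end Summit.CriticalPhenomena.SAWScalingLimit.Theorems.AvoidanceLimit.Corner

end
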